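import Summits.CriticalPhenomena.PercolationContinuityZ3.Theorems.PercNearOneGluingNoHeavyLowerTailSahiCTCLadderPrep
import Summits.CriticalPhenomena.PercolationContinuityZ3.Theorems.PercNearOneGluingNoHeavyLowerTailSahiCTCLadderRowOne
import Summits.CriticalPhenomena.PercolationContinuityZ3.Theorems.PercNearOneGluingNoHeavyLowerTailSahiCTCLadderRowTwo
import HarnessLib

/-!
# `NoHeavyLowerTail` (crux stmt-CriticalPhenomena-4575), P3 lane: the ladder form coefficient by coefficient — preliminaries and shapes I (memo g25)

Support file (seat `prim-l12-p3`, gen 25; `--supports stmt-CriticalPhenomena-4575`).  Assembly of the coefficientwise proof of the ladder conjecture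
(memo g24 §5.5, memo g25): for up-sets `𝒳, 𝒵 ⊆ 2^α` all of whose members have ≥ 2 elements,
    `L₂(𝒳,𝒵) = e₂·(Π·GF(𝒳∩𝒵) − GF(𝒳)GF(𝒵)) − Θ₁·e_{≥2}·GF((𝒳∩𝒵)₂) ∈ ℕ[s]`
(`…SahiCTCLadderTwo.coeff_ladder_two_nonneg`, no nestedness hypothesis).  Per profile `m`: the charge side is `Σ_{e ∈ W(supp m)} γ(m − 1_e)`
(`…LadderPrep`), the surplus side dominates sums of Kleitman surpluses of traces, and the rows of `…LadderRowsA/RowOne/RowTwo` compare the two by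
the shape of `m`.  This file: preliminaries (`support_eq_lev_union`, `cedges_insert`, `sum_cedges_insert`, `coeff_harris_residual`, the `charge_*`
bounds) and the shapes "squarefree" (`shape_sqfree`) and "one doubled point" (`shape_one`).  Nothing is asserted about the crux.
-/

namespace Summit.CriticalPhenomena.PercolationContinuityZ3.Theorems.SahiCTCForms

open Finset MvPolynomial SahiCTCGenFun

variable {α : Type*} [DecidableEq α] [Fintype α]

section Prelim
variable {𝒳 𝒵 : Finset (Finset α)} {m : α →₀ ℕ}

omit [Fintype α] in
/-- The support of a profile `m ≤ 3` is the union of its three level sets. [this work] -/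
theorem support_eq_lev_union (h3 : ∀ i, m i ≤ 3) : m.support = lev m 3 ∪ lev m 2 ∪ lev m 1 := by
  ext i
  rw [Finsupp.mem_support_iff, mem_union, mem_union, mem_lev (by norm_num), mem_lev (by norm_num), mem_lev (by norm_num)]
  have := h3 i; omega

omit [DecidableEq α] [Fintype α] in
/-- Distinct level sets are disjoint. [this work] -/
theorem disjoint_lev {k k' : ℕ} (hk : k ≠ 0) (hk' : k' ≠ 0) (hkk' : k ≠ k') : Disjoint (lev m k) (lev m k') :=
  Finset.disjoint_left.2 fun _ h h' => hkk' (((mem_lev hk).1 h).symm.trans ((mem_lev hk').1 h'))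

omit [Fintype α] in
/-- The index set of the charge side is the set of common 2-sets inside the support. [this work] -/
theorem filter_W_eq_cedges (m : α →₀ ℕ) :
    ((𝒳 ∩ 𝒵).filter fun S => #S = 2).filter (fun e => ind e ≤ m) = cedges 𝒳 𝒵 m.support := by
  ext e; rw [mem_filter, mem_filter, mem_inter, mem_cedges, SahiAllButC.ind_le_iff_subset_support]; tauto

omit [Fintype α] in
/-- Peeling a point: the common 2-sets inside `d ∪ T` are the pairs `{d,y}` (`y` a common neighbour of `d`) and the common 2-sets inside `T`. [this work] -/
theorem cedges_insert {d : α} {T : Finset α} (hdT : d ∉ T) :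
    cedges 𝒳 𝒵 (insert d T) = ((cnbrs 𝒳 𝒵 (insert d T) d).image fun y => ({d, y} : Finset α)) ∪ cedges 𝒳 𝒵 T := by
  ext e
  rw [mem_union, mem_image, mem_cedges, mem_cedges]
  constructor
  · rintro ⟨heS, he2, hX, hZ⟩
    by_cases hde : d ∈ e
    · left
      obtain ⟨a, b, hab, rfl⟩ := card_eq_two.1 he2
      simp only [mem_insert, mem_singleton] at hde
      rcases hde with rfl | rfl
      · have hb : b ∈ T := by
          have := heS (show b ∈ ({d, b} : Finset α) by simp)
          rcases mem_insert.1 this with h | h; exact absurd h hab.symm; exact h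
        exact ⟨b, (mem_cnbrs_insert hdT).2 ⟨hb, hX, hZ⟩, rfl⟩
      · have ha : a ∈ T := by
          have := heS (show a ∈ ({a, d} : Finset α) by simp)
          rcases mem_insert.1 this with h | h; exact absurd h hab; exact h
        refine ⟨a, (mem_cnbrs_insert hdT).2 ⟨ha, ?_, ?_⟩, pair_comm _ _⟩ <;> rw [pair_comm] <;> assumption
    · right
      exact ⟨fun x hx => by
        rcases mem_insert.1 (heS hx) with h | h
        · exact absurd hx (h ▸ hde)
        · exact h, he2, hX, hZ⟩
  · rintro (⟨y, hy, rfl⟩ | ⟨heT, he2, hX, hZ⟩)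
    · obtain ⟨hyT, hX, hZ⟩ := (mem_cnbrs_insert hdT).1 hy
      have hdy : d ≠ y := fun h => hdT (h ▸ hyT)
      exact ⟨insert_subset (mem_insert_self _ _) (singleton_subset_iff.2 (mem_insert_of_mem hyT)), card_pair hdy, hX, hZ⟩
    · exact ⟨heT.trans (subset_insert _ _), he2, hX, hZ⟩

omit [Fintype α] in
/-- The two parts of `cedges_insert` are disjoint. [this work] -/
theorem disjoint_cedges_insert {d : α} {T : Finset α} (hdT : d ∉ T) :
    Disjoint ((cnbrs 𝒳 𝒵 (insert d T) d).image fun y => ({d, y} : Finset α)) (cedges 𝒳 𝒵 T) :=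
  Finset.disjoint_left.2 fun e h1 h2 => by
    obtain ⟨y, _, rfl⟩ := mem_image.1 h1
    exact hdT ((mem_cedges.1 h2).1 (by simp))

omit [Fintype α] in
/-- `y ↦ {d,y}` is injective on a set avoiding `d`. [this work] -/
theorem injOn_pair (d : α) {S : Finset α} (hdS : d ∉ S) : Set.InjOn (fun y => ({d, y} : Finset α)) ↑S := by
  intro y hy y' hy' h
  have hyd : y ≠ d := fun hh => hdS (hh ▸ Finset.mem_coe.1 hy)
  have h' : ({d, y} : Finset α) = {d, y'} := h
  have : y ∈ ({d, y'} : Finset α) := by rw [← h']; simp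
  simp only [mem_insert, mem_singleton] at this
  rcases this with h1 | h1
  · exact absurd h1 hyd
  · exact h1

omit [Fintype α] in
/-- Splitting a sum over the common 2-sets inside `d ∪ T`. [this work] -/
theorem sum_cedges_insert {β : Type*} [AddCommMonoid β] {d : α} {T : Finset α} (hdT : d ∉ T) (f : Finset α → β) :
    ∑ e ∈ cedges 𝒳 𝒵 (insert d T), f e = ∑ y ∈ cnbrs 𝒳 𝒵 (insert d T) d, f {d, y} + ∑ e ∈ cedges 𝒳 𝒵 T, f e := by
  rw [cedges_insert hdT, sum_union (disjoint_cedges_insert hdT), sum_image]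
  exact injOn_pair d fun h => hdT (((mem_cnbrs_insert hdT).1 h).1)

/-- The residual Harris coefficient at an admissible `E ⊇ lev m 3` is a Kleitman surplus of traces. [this work] -/
theorem coeff_harris_residual (h3 : ∀ i, m i ≤ 3) {E : Finset α} (hME : lev m 3 ⊆ E) :
    (PiP * gf (𝒳 ∩ 𝒵) - gf 𝒳 * gf 𝒵).coeff (m - ind E) =
      kap 𝒳 𝒵 ((lev m 3 ∩ E) ∪ (lev m 2 \ E)) ((lev m 2 ∩ E) ∪ (lev m 1 \ E)) := by
  rw [coeff_harrisForm_eq_kap _ _ ((sub_ind_le_two_iff h3).2 hME), dbl_sub_ind h3, sgl_sub_ind h3 hME]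

/-- The charge `γ(m − 1_e)` vanishes unless the tripled points lie in `e`. [this work] -/
theorem charge_eq_zero_of_not_subset (h3 : ∀ i, m i ≤ 3) {e : Finset α} (hMe : ¬ lev m 3 ⊆ e) :
    ((Th1 : MvPolynomial α ℤ) * gf (bySize (2 ≤ ·) : Finset (Finset α))).coeff (m - ind e) = 0 :=
  coeff_Th1_mul_atLeastTwo_eq_zero fun h => hMe ((sub_ind_le_two_iff h3).1 h)

/-- The charge vanishes when the residual profile has ≥ 2 doubled points. [this work] -/
theorem charge_eq_zero_of_two_le (h3 : ∀ i, m i ≤ 3) {e : Finset α} (hMe : lev m 3 ⊆ e)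
    (h2 : 2 ≤ #((lev m 3 ∩ e) ∪ (lev m 2 \ e))) :
    ((Th1 : MvPolynomial α ℤ) * gf (bySize (2 ≤ ·) : Finset (Finset α))).coeff (m - ind e) = 0 := by
  have hle := (sub_ind_le_two_iff h3).2 hMe
  exact coeff_Th1_mul_atLeastTwo_eq_zero_of_two_le hle (by rw [dbl_sub_ind h3]; exact h2)

/-- The charge is ≤ `[1 ≤ t']` when the residual profile has one doubled point. [this work] -/
theorem charge_le_one (h3 : ∀ i, m i ≤ 3) {e : Finset α} (hMe : lev m 3 ⊆ e)
    (h1 : #((lev m 3 ∩ e) ∪ (lev m 2 \ e)) = 1) :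
    ((Th1 : MvPolynomial α ℤ) * gf (bySize (2 ≤ ·) : Finset (Finset α))).coeff (m - ind e) ≤
      if 1 ≤ #((lev m 2 ∩ e) ∪ (lev m 1 \ e)) then 1 else 0 := by
  have hle := (sub_ind_le_two_iff h3).2 hMe
  have := coeff_Th1_mul_atLeastTwo_le_one hle (by rw [dbl_sub_ind h3]; exact h1)
  rw [sgl_sub_ind h3 hMe] at this; exact this

/-- The charge is ≤ `[2 ≤ t'] + [3 ≤ t']·t'` when the residual profile is squarefree. [this work] -/
theorem charge_le_sqfree (h3 : ∀ i, m i ≤ 3) {e : Finset α} (hMe : lev m 3 ⊆ e)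
    (h0 : #((lev m 3 ∩ e) ∪ (lev m 2 \ e)) = 0) :
    ((Th1 : MvPolynomial α ℤ) * gf (bySize (2 ≤ ·) : Finset (Finset α))).coeff (m - ind e) ≤
      (if 2 ≤ #((lev m 2 ∩ e) ∪ (lev m 1 \ e)) then 1 else 0)
        + (if 3 ≤ #((lev m 2 ∩ e) ∪ (lev m 1 \ e)) then (#((lev m 2 ∩ e) ∪ (lev m 1 \ e)) : ℤ) else 0) := by
  have hle := (sub_ind_le_two_iff h3).2 hMe
  have := coeff_Th1_mul_atLeastTwo_le_sqfree hle (by rw [dbl_sub_ind h3]; exact h0)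
  rw [sgl_sub_ind h3 hMe] at this; exact this

/-- The surplus side is ≥ 0. [this work] -/
theorem surplus_nonneg (h𝒳 : IsUpperSet (𝒳 : Set (Finset α))) (h𝒵 : IsUpperSet (𝒵 : Set (Finset α))) (m : α →₀ ℕ) :
    0 ≤ (ee 2 * (PiP * gf (𝒳 ∩ 𝒵) - gf 𝒳 * gf 𝒵)).coeff m := by
  have := sum_le_coeff_ee_two_mul_harris h𝒳 h𝒵 m (S := ∅) (empty_subset _)
  rwa [sum_empty] at this

end Prelim

section Shapes
variable {𝒳 𝒵 : Finset (Finset α)} {m : α →₀ ℕ}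

/-- If every charge vanishes the row is trivial. [this work] -/
theorem shape_zero (h𝒳 : IsUpperSet (𝒳 : Set (Finset α))) (h𝒵 : IsUpperSet (𝒵 : Set (Finset α)))
    (hz : ∀ e ∈ cedges 𝒳 𝒵 m.support, ((Th1 : MvPolynomial α ℤ) * gf (bySize (2 ≤ ·) : Finset (Finset α))).coeff (m - ind e) = 0) :
    ∑ e ∈ cedges 𝒳 𝒵 m.support, ((Th1 : MvPolynomial α ℤ) * gf (bySize (2 ≤ ·) : Finset (Finset α))).coeff (m - ind e)
      ≤ (ee 2 * (PiP * gf (𝒳 ∩ 𝒵) - gf 𝒳 * gf 𝒵)).coeff m := by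
  rw [sum_congr rfl hz, sum_const_zero]; exact surplus_nonneg h𝒳 h𝒵 m

/-- The 2-subsets of a subset of the support are admissible. [this work] -/
theorem powersetCard_two_admissible {T : Finset α} (hT : T ⊆ m.support) :
    T.powersetCard 2 ⊆ (bySize (· = 2) : Finset (Finset α)).filter fun E => ind E ≤ m := fun E hE => by
  obtain ⟨hET, hE2⟩ := mem_powersetCard.1 hE
  refine mem_filter.2 ⟨?_, (SahiAllButC.ind_le_iff_subset_support _ _).2 (hET.trans hT)⟩
  unfold bySize; exact mem_filter.2 ⟨mem_powerset.2 (subset_univ _), hE2⟩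

/-- **Shape (ii)**: squarefree profiles. [this work] -/
theorem shape_sqfree (h𝒳 : IsUpperSet (𝒳 : Set (Finset α))) (h𝒵 : IsUpperSet (𝒵 : Set (Finset α)))
    (hX2 : ∀ U ∈ 𝒳, 2 ≤ #U) (hZ2 : ∀ U ∈ 𝒵, 2 ≤ #U) (h3 : ∀ i, m i ≤ 3) (hM : lev m 3 = ∅) (hD : lev m 2 = ∅) :
    ∑ e ∈ cedges 𝒳 𝒵 m.support, ((Th1 : MvPolynomial α ℤ) * gf (bySize (2 ≤ ·) : Finset (Finset α))).coeff (m - ind e)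
      ≤ (ee 2 * (PiP * gf (𝒳 ∩ 𝒵) - gf 𝒳 * gf 𝒵)).coeff m := by
  have hsupp : m.support = lev m 1 := by rw [support_eq_lev_union h3, hM, hD, empty_union, empty_union]
  rw [hsupp]
  set T := lev m 1 with hT
  -- charge side
  have hB : ∑ e ∈ cedges 𝒳 𝒵 T, ((Th1 : MvPolynomial α ℤ) * gf (bySize (2 ≤ ·) : Finset (Finset α))).coeff (m - ind e)
      ≤ (#(cedges 𝒳 𝒵 T) : ℤ) * ((if 4 ≤ #T then 1 else 0) + (if 5 ≤ #T then (#T : ℤ) - 2 else 0)) := by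
    have hterm : ∀ e ∈ cedges 𝒳 𝒵 T, ((Th1 : MvPolynomial α ℤ) * gf (bySize (2 ≤ ·) : Finset (Finset α))).coeff (m - ind e)
        ≤ (if 4 ≤ #T then 1 else 0) + (if 5 ≤ #T then (#T : ℤ) - 2 else 0) := fun e he => by
      obtain ⟨heT, he2, -, -⟩ := mem_cedges.1 he
      have hMe : lev m 3 ⊆ e := by rw [hM]; exact empty_subset _
      have h := charge_le_sqfree h3 hMe (by rw [hM, hD, empty_inter, empty_sdiff, empty_union, card_empty])
      have hc : #((lev m 2 ∩ e) ∪ (lev m 1 \ e)) = #T - 2 := by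
        rw [hD, empty_inter, empty_union, ← hT, card_sdiff_of_subset heT, he2]
      rw [hc] at h
      have h2T : 2 ≤ #T := by have := card_le_card heT; rw [he2] at this; exact this
      have e1 : (if 2 ≤ #T - 2 then (1 : ℤ) else 0) = if 4 ≤ #T then 1 else 0 := by
        by_cases h4 : 4 ≤ #T
        · rw [if_pos h4, if_pos (by omega)]
        · rw [if_neg h4, if_neg (by omega)]
      have e2 : (if 3 ≤ #T - 2 then ((#T - 2 : ℕ) : ℤ) else 0) = if 5 ≤ #T then (#T : ℤ) - 2 else 0 := by
        by_cases h5 : 5 ≤ #T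
        · rw [if_pos h5, if_pos (by omega)]; push_cast [Nat.cast_sub h2T]; ring
        · rw [if_neg h5, if_neg (by omega)]
      rw [e1, e2] at h; exact h
    refine (sum_le_sum hterm).trans ?_
    rw [sum_const, nsmul_eq_mul]
  -- surplus side
  have hA := row_sqfree h𝒳 h𝒵 hX2 hZ2 T
  have hA' : ∑ E ∈ T.powersetCard 2, kap 𝒳 𝒵 ∅ (T \ E) ≤ (ee 2 * (PiP * gf (𝒳 ∩ 𝒵) - gf 𝒳 * gf 𝒵)).coeff m := by
    have h := sum_le_coeff_ee_two_mul_harris h𝒳 h𝒵 m (powersetCard_two_admissible (T := T) (by rw [hsupp]))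
    rw [sum_congr rfl fun E hE => coeff_harris_residual (𝒳 := 𝒳) (𝒵 := 𝒵) h3 (by rw [hM]; exact empty_subset E)] at h
    simp only [hM, hD, empty_inter, empty_sdiff, empty_union] at h
    exact h
  linarith

/-- **Shape (v)**: one doubled point, no tripled point. [this work] -/
theorem shape_one (h𝒳 : IsUpperSet (𝒳 : Set (Finset α))) (h𝒵 : IsUpperSet (𝒵 : Set (Finset α)))
    (hX2 : ∀ U ∈ 𝒳, 2 ≤ #U) (hZ2 : ∀ U ∈ 𝒵, 2 ≤ #U) (h3 : ∀ i, m i ≤ 3) (hM : lev m 3 = ∅) {d : α} (hD : lev m 2 = {d}) :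
    ∑ e ∈ cedges 𝒳 𝒵 m.support, ((Th1 : MvPolynomial α ℤ) * gf (bySize (2 ≤ ·) : Finset (Finset α))).coeff (m - ind e)
      ≤ (ee 2 * (PiP * gf (𝒳 ∩ 𝒵) - gf 𝒳 * gf 𝒵)).coeff m := by
  set T := lev m 1 with hT
  have hdT : d ∉ T := fun h => by
    have := disjoint_lev (m := m) (k := 2) (k' := 1) (by norm_num) (by norm_num) (by norm_num)
    rw [hD, disjoint_singleton_left] at this; exact this h
  have hsupp : m.support = insert d T := by rw [support_eq_lev_union h3, hM, hD, empty_union]; rfl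
  rw [hsupp, sum_cedges_insert hdT]
  have hMe : ∀ e : Finset α, lev m 3 ⊆ e := fun e => by rw [hM]; exact empty_subset e
  -- charges at the pairs {d,y}
  have h1 : ∀ y ∈ cnbrs 𝒳 𝒵 (insert d T) d,
      ((Th1 : MvPolynomial α ℤ) * gf (bySize (2 ≤ ·) : Finset (Finset α))).coeff (m - ind {d, y})
        ≤ (if 2 ≤ #T then 1 else 0) + (if 3 ≤ #T then (#T : ℤ) else 0) := fun y hy => by
    have hyT := ((mem_cnbrs_insert hdT).1 hy).1
    have h := charge_le_sqfree h3 (e := ({d, y} : Finset α)) (hMe _)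
      (by rw [hM, hD, empty_inter, empty_union, card_eq_zero, sdiff_eq_empty_iff_subset]; simp)
    have hc : #((lev m 2 ∩ {d, y}) ∪ (lev m 1 \ {d, y})) = #T := by
      rw [hD, ← hT, (inter_eq_left.2 (singleton_subset_iff.2 (mem_insert_self d {y})) : ({d} : Finset α) ∩ {d, y} = {d}),
        show T \ {d, y} = T.erase y from by
          ext x; simp only [mem_sdiff, mem_insert, mem_singleton, mem_erase, not_or]
          exact ⟨fun ⟨h1, h2, h3⟩ => ⟨h3, h1⟩, fun ⟨h1, h2⟩ => ⟨h2, fun h => hdT (h ▸ h2), h1⟩⟩,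
        card_union_of_disjoint (by rw [disjoint_singleton_left]; exact fun h => hdT (mem_of_mem_erase h)),
        card_singleton, card_erase_of_mem hyT]
      have := card_pos.2 ⟨y, hyT⟩; omega
    rw [hc] at h; exact h
  -- charges at the pairs inside T
  have h2 : ∀ e ∈ cedges 𝒳 𝒵 T,
      ((Th1 : MvPolynomial α ℤ) * gf (bySize (2 ≤ ·) : Finset (Finset α))).coeff (m - ind e) ≤ (if 3 ≤ #T then 1 else 0) := fun e he => by
    obtain ⟨heT, he2, -, -⟩ := mem_cedges.1 he
    have hde : d ∉ e := fun h => hdT (heT h)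
    have h := charge_le_one h3 (e := e) (hMe _) (by
      rw [hM, hD, empty_inter, empty_union, sdiff_eq_self_of_disjoint (disjoint_singleton_left.2 hde), card_singleton])
    have hc : #((lev m 2 ∩ e) ∪ (lev m 1 \ e)) = #T - 2 := by
      rw [hD, ← hT, show ({d} : Finset α) ∩ e = ∅ from by rw [singleton_inter_of_notMem hde], empty_union,
        card_sdiff_of_subset heT, he2]
    rw [hc] at h
    by_cases h3T : 3 ≤ #T
    · rw [if_pos h3T]; rw [if_pos (by omega)] at h; exact h
    · rw [if_neg h3T]; rw [if_neg (by omega)] at h; exact h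
  have hB := add_le_add (sum_le_sum h1) (sum_le_sum h2)
  rw [sum_const, sum_const, nsmul_eq_mul, nsmul_eq_mul] at hB
  -- surplus side: the cubes of row (v)
  have hA := rowOne_le h𝒳 h𝒵 hX2 hZ2 (d := d) (#T) T rfl hdT
  have hpairs : T.image (fun y => ({d, y} : Finset α)) ⊆ (bySize (· = 2) : Finset (Finset α)).filter fun E => ind E ≤ m := fun E hE => by
    obtain ⟨y, hy, rfl⟩ := mem_image.1 hE
    exact pair_mem_admissible (fun h => hdT (h ▸ hy)) (by rw [hsupp]; exact mem_insert_self _ _) (by rw [hsupp]; exact mem_insert_of_mem hy)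
  have hdisj : Disjoint (T.image fun y => ({d, y} : Finset α)) (T.powersetCard 2) :=
    Finset.disjoint_left.2 fun E h1 h2 => by
      obtain ⟨y, _, rfl⟩ := mem_image.1 h1
      exact hdT ((mem_powersetCard.1 h2).1 (by simp))
  have hS := sum_le_coeff_ee_two_mul_harris h𝒳 h𝒵 m (S := T.image (fun y => ({d, y} : Finset α)) ∪ T.powersetCard 2)
    (union_subset hpairs (powersetCard_two_admissible (by rw [hsupp]; exact subset_insert _ _)))
  rw [sum_union hdisj, sum_image (injOn_pair d hdT)] at hS
  rw [sum_congr rfl fun y hy => coeff_harris_residual (𝒳 := 𝒳) (𝒵 := 𝒵) h3 (hMe {d, y}),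
    sum_congr rfl fun E hE => coeff_harris_residual (𝒳 := 𝒳) (𝒵 := 𝒵) h3 (hMe E)] at hS
  have eq1 : ∀ y ∈ T, kap 𝒳 𝒵 ((lev m 3 ∩ {d, y}) ∪ (lev m 2 \ {d, y})) ((lev m 2 ∩ {d, y}) ∪ (lev m 1 \ {d, y}))
      = kap 𝒳 𝒵 ∅ (insert d (T.erase y)) := fun y hy => by
    congr 1
    · rw [hM, hD, empty_inter, empty_union, sdiff_eq_empty_iff_subset]; simp
    · rw [hD, ← hT, (inter_eq_left.2 (singleton_subset_iff.2 (mem_insert_self d {y})) : ({d} : Finset α) ∩ {d, y} = {d})]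
      ext x; simp only [mem_union, mem_singleton, mem_sdiff, mem_insert, mem_erase, not_or]
      constructor
      · rintro (rfl | ⟨h1, h2, h3⟩); exact Or.inl rfl; exact Or.inr ⟨h3, h1⟩
      · rintro (rfl | ⟨h1, h2⟩); exact Or.inl rfl; exact Or.inr ⟨h2, fun h => hdT (h ▸ h2), h1⟩
  have eq2 : ∀ E ∈ T.powersetCard 2, kap 𝒳 𝒵 ((lev m 3 ∩ E) ∪ (lev m 2 \ E)) ((lev m 2 ∩ E) ∪ (lev m 1 \ E))
      = kap 𝒳 𝒵 {d} (T \ E) := fun E hE => by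
    have hET := (mem_powersetCard.1 hE).1
    have hdE : d ∉ E := fun h => hdT (hET h)
    congr 1
    · rw [hM, hD, empty_inter, empty_union, sdiff_eq_self_of_disjoint (disjoint_singleton_left.2 hdE)]
    · rw [hD, ← hT, singleton_inter_of_notMem hdE, empty_union]
  rw [sum_congr rfl eq1, sum_congr rfl eq2] at hS
  -- compare
  refine le_trans hB (le_trans ?_ (hA.trans hS))
  by_cases h3T : 3 ≤ #T
  · rw [if_pos h3T, if_pos (by omega), if_pos h3T, if_pos h3T]; linarith
  · rw [if_neg h3T, if_neg h3T, if_neg h3T]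
    by_cases h2T : #T = 2
    · rw [if_pos (by omega), if_pos h2T]; linarith
    · rw [if_neg (by omega), if_neg h2T]; linarith

end Shapes

end Summit.CriticalPhenomena.PercolationContinuityZ3.Theorems.SahiCTCForms
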